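import Mathlib.Tactic
import HarnessLib

/-!
# Kozma–Nitzan's Question 8 at three relays — the universal k = 2 step of the uniform form, depth-0 weight zero (gen 31)

Support file (`--supports stmt-CriticalPhenomena-4575`, closed crux; independent mathematics on Kozma–Nitzan's Question 8,
arXiv:2401.12397 §5.5 p. 36), prover `prim-ineq-gen-6` (gen 31).  No definitions, no named facts, no sorries; standard axioms.
Memo `run/shared/lean/prim/prim-ineq-gen-6/FINDING-G31.md` §5b.

In vertex-1 / T₂-channel coordinates (FINDING-G31 §5) the k = 2 instance of the merge step (M‴) with depth-0 weight `w = 0` reads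
`N3 ≤ Kb + LL′`: the depth-1 excess `C(v/p)·s·λ(A−C)·u` (present only when `A₁ > C₁`) is paid by the depth-1 K-kill and the L-kill.
After dividing by `C(v/p)·u·s` and writing `x = v/m` it is the quadratic fact `quadQ_nonneg` below (LEMMA Q of the memo), whose two
cases are 'vertex left of λ′' and 'non-positive discriminant'.  `k2_w0_core` assembles the step from the three structural facts of
`T₂` that the memo isolates: `v ≥ λ′·m` (C-defect of the crossing vertex), `T′·m ≥ u·v` (Chebyshev on the nested root classes) and
`T′ ≥ 0`; here `λ′ = (1+λ)C − 1 ≥ 0` because vertex 1 is not crossed.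
[cite: KozmaNitzan2024, Question 8 (§5.5 p. 36)]
-/

namespace Summit.CriticalPhenomena.PercolationContinuityZ3.Theorems

namespace PocketCert

/-- **LEMMA Q.**  For `0 < λ < 1`, `0 < C ≤ A ≤ 1` with `λ′ := (1+λ)C − 1 ≥ 0` and `x ≥ λ′`:
`x² − x·(λ′ + λ(A−C)) + (1−C)·λ²·A ≥ 0`.  (Value at `x = λ′` is `λC[λ(C − A(1−δ)) + δ(A−C)] ≥ 0`; if the vertex lies right of `λ′`
then `λ(A−C) > λ′` and the discriminant is `≤ 4λ²[(A−C)² − (1−C)A] ≤ 0`.)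
[cite: KozmaNitzan2024, Question 8 (§5.5 p. 36)] -/
theorem quadQ_nonneg (lam A C x : ℝ) (hl0 : 0 < lam) (hl1 : lam < 1) (hC0 : 0 < C) (hCA : C ≤ A) (hA1 : A ≤ 1)
    (hlp : 0 ≤ (1 + lam) * C - 1) (hx : (1 + lam) * C - 1 ≤ x) :
    0 ≤ x ^ 2 - x * ((1 + lam) * C - 1 + lam * (A - C)) + (1 - C) * lam ^ 2 * A := by
  set lp := (1 + lam) * C - 1 with hlpdef
  have hC1 : C ≤ 1 := le_trans hCA hA1
  have hAC : 0 ≤ A - C := by linarith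
  -- value at x = lp is nonnegative:  lp^2 - lp(lp + lam(A-C)) + (1-C) lam^2 A = lam [ (1-C) lam A - lp (A-C) ]
  have hval : 0 ≤ lp ^ 2 - lp * (lp + lam * (A - C)) + (1 - C) * lam ^ 2 * A := by
    have h1 : lp ^ 2 - lp * (lp + lam * (A - C)) + (1 - C) * lam ^ 2 * A
        = lam * ((1 - C) * lam * A - lp * (A - C)) := by ring
    rw [h1]
    apply mul_nonneg hl0.le
    -- (1-C) lam A - ((1+lam)C - 1)(A-C) = lam (C - A C) + ... expand:
    -- = lam A - lam A C - (A C + lam A C - A - C^2 - lam C^2 + C)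
    -- = lam A - 2 lam A C + lam C^2 - A C + A + C^2 - C = lam (A - 2AC + C^2) + (1-C)(A - C)...
    nlinarith [mul_nonneg hAC (sub_nonneg.mpr hC1), mul_nonneg (sub_nonneg.mpr hA1) hC0.le,
               mul_nonneg (mul_nonneg hl0.le hC0.le) (sub_nonneg.mpr hA1), sq_nonneg (A - C),
               mul_nonneg hl0.le (sq_nonneg (A - C)), mul_nonneg hl0.le (mul_nonneg (sub_nonneg.mpr hA1) hC0.le)]
  rcases le_or_gt (lam * (A - C)) lp with hleft | hright
  · -- vertex (lp + lam(A-C))/2 ≤ lp ≤ x : the quadratic is non-decreasing on [lp, ∞)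
    have hmono : lp ^ 2 - lp * (lp + lam * (A - C)) ≤ x ^ 2 - x * (lp + lam * (A - C)) := by
      have : (x - lp) * (x + lp - (lp + lam * (A - C))) ≥ 0 := by
        apply mul_nonneg (by linarith) (by linarith)
      nlinarith [this]
    linarith
  · -- discriminant ≤ 0 :  (lp + lam(A-C))^2 ≤ 4 lam^2 (A-C)^2 ≤ 4 (1-C) lam^2 A
    have hb : lp + lam * (A - C) ≤ 2 * (lam * (A - C)) := by linarith
    have hb0 : 0 ≤ lp + lam * (A - C) := by nlinarith
    have hsq : (lp + lam * (A - C)) ^ 2 ≤ 4 * (lam * (A - C)) ^ 2 := by nlinarith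
    have hkey : (A - C) ^ 2 ≤ (1 - C) * A := by nlinarith
    have hdisc : (lp + lam * (A - C)) ^ 2 ≤ 4 * ((1 - C) * lam ^ 2 * A) := by
      have : 4 * (lam * (A - C)) ^ 2 ≤ 4 * ((1 - C) * lam ^ 2 * A) := by
        have := mul_le_mul_of_nonneg_left hkey (by positivity : (0:ℝ) ≤ 4 * lam ^ 2)
        nlinarith [this]
      linarith
    -- x^2 - b x + c ≥ 0 when b^2 ≤ 4c :  4(x^2 - bx + c) = (2x - b)^2 + (4c - b^2)
    nlinarith [sq_nonneg (2 * x - (lp + lam * (A - C))), hdisc]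

/-- **The w = 0 case of the k = 2 merge step (M‴), core chain.**  With `x = v/m` (`m > 0`), the structural facts `v ≥ λ′m`,
`T′m ≥ uv`, and LEMMA Q give
`s·λ(A−C)·u·v ≤ v·[(ω·M₁ + s)·T′ − s·λ′·u] + (1−C)·λ²·A·s·m·u`  — the right side is `(p/C)·[Kb-part + LL′-part]` of the memo
(`Kb ⊇ C(v/p)[(ωM₁+s)T′ − sλ′u]`, `LL′ ≥ (1−C)λ²·A·C·s·m·u/p` from `m₁ ≥ A·C·s·m`), all other kill terms being non-negative and dropped.
Hypotheses: `0 < λ < 1`, `0 < C ≤ A ≤ 1`, `λ′ = (1+λ)C−1 ≥ 0`, `0 ≤ s ≤ 1`, `M₁ ≥ 0`, `u, v ≥ 0`, `m > 0`, `T′·m ≥ u·v`, `v ≥ λ′·m`.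
[cite: KozmaNitzan2024, Question 8 (§5.5 p. 36)] -/
theorem k2_w0_core (lam A C s M₁ u v m T' : ℝ) (hl0 : 0 < lam) (hl1 : lam < 1) (hC0 : 0 < C) (hCA : C ≤ A) (hA1 : A ≤ 1)
    (hlp : 0 ≤ (1 + lam) * C - 1) (hs0 : 0 ≤ s) (hs1 : s ≤ 1) (hM : 0 ≤ M₁) (hu : 0 ≤ u) (hv : 0 ≤ v) (hm : 0 < m)
    (hcheb : u * v ≤ T' * m) (hvm : ((1 + lam) * C - 1) * m ≤ v) :
    s * lam * (A - C) * u * v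
      ≤ v * (((1 - s) * M₁ + s) * T' - s * ((1 + lam) * C - 1) * u) + (1 - C) * lam ^ 2 * A * s * m * u := by
  have hT : 0 ≤ T' := by
    by_contra h
    have h' : T' < 0 := lt_of_not_ge h
    have : T' * m < 0 := mul_neg_of_neg_of_pos h' hm
    nlinarith [mul_nonneg hu hv]
  have hm0 : m ≠ 0 := ne_of_gt hm
  -- LEMMA Q at x = v/m
  have hx : (1 + lam) * C - 1 ≤ v / m := by rw [le_div_iff₀ hm]; linarith
  have hQ := quadQ_nonneg lam A C (v / m) hl0 hl1 hC0 hCA hA1 hlp hx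
  -- multiply by m² :  v² − v·m·(λ′ + λ(A−C)) + (1−C)λ²A·m² ≥ 0
  have hQm : 0 ≤ v ^ 2 - v * m * ((1 + lam) * C - 1 + lam * (A - C)) + (1 - C) * lam ^ 2 * A * m ^ 2 := by
    have h := mul_nonneg hQ (sq_nonneg m)
    have e : ((v / m) ^ 2 - v / m * ((1 + lam) * C - 1 + lam * (A - C)) + (1 - C) * lam ^ 2 * A) * m ^ 2
        = v ^ 2 - v * m * ((1 + lam) * C - 1 + lam * (A - C)) + (1 - C) * lam ^ 2 * A * m ^ 2 := by
      field_simp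
    rw [e] at h
    exact h
  -- Chebyshev + T' ≥ 0 :  m·v·((1−s)M₁ + s)·T′ ≥ s·u·v²
  have hωM : 0 ≤ (1 - s) * M₁ := mul_nonneg (by linarith) hM
  have h1 : s * u * v ^ 2 ≤ m * (v * (((1 - s) * M₁ + s) * T')) := by
    have hc : s * (u * v) ≤ s * (T' * m) := mul_le_mul_of_nonneg_left hcheb hs0
    have hextra : 0 ≤ m * (v * ((1 - s) * M₁ * T')) := by positivity
    nlinarith [mul_le_mul_of_nonneg_left hc hv, hextra]
  -- assemble at the level of m·(target)
  have hsu : 0 ≤ s * u := mul_nonneg hs0 hu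
  have hQ2 := mul_nonneg hsu hQm
  have hgoal : m * (s * lam * (A - C) * u * v)
      ≤ m * (v * (((1 - s) * M₁ + s) * T' - s * ((1 + lam) * C - 1) * u) + (1 - C) * lam ^ 2 * A * s * m * u) := by
    nlinarith [hQ2, h1]
  exact le_of_mul_le_mul_left hgoal hm

end PocketCert

end Summit.CriticalPhenomena.PercolationContinuityZ3.Theorems
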